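import Literature.InformationTheory.QuantumCodes.QuantumExpanderNoisySyndromeTheorem13Concrete
import HarnessLib

/-!
# Small-set-flip with a NOISY syndrome (Fawzi–Grospellier–Leverrier, FOCS 2018), part 12: Theorem 13 in the printed SHAPE
# "`E_ls` is locally stochastic with parameter `K·p^{1/c}` on succ", `K` independent of the code size — PROOF (our constants)

Index of sources: `[cite: FawziGrospellierLeverrier2018FT]` = Fawzi–Grospellier–Leverrier, FOCS 2018 / arXiv:1808.03821, Thm. 13 (p0016 L66-73: "conditioned on
succ, `E_ls` has a local stochastic distribution with parameter `K p_synd^{1/c₀}` where `K` is a constant independent of `p_synd`") and the last line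
of its proof (p0022 L19-20: "If `p_synd` is sufficiently small, then we can make this `≤ (K p_synd^{1/c₀})^{|S|}`").

Topic `Literature/InformationTheory/QuantumCodes` (venture QEC, row 04 `prover-qec-type-04` gen 8, line L-SSF-NOISY = PARTITION v2.48 D50.L8, node N22). Part 11
gives the local-stochastic bound with the size-dependent factor `1 + Σ_{k ≤ n} Δ_Q^{2(k−1)}(√y)^k`; under the smallness condition `Δ_Q²·√y ≤ 1/2`
(`y = 2^{max Δ}·p^{1/c₀}`, `Δ_Q = 2·max Δ·(Δ_A+Δ_B−1)`; a condition on `p` only, uniform in `n`) that factor is `≤ 1 + 2√y ≤ 2`, so the parameter is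
`≤ 2√y = 2·2^{max Δ/2}·p^{1/(2c₀)}` — the printed shape `K·p^{1/c}` with `K = 2^{1 + max Δ/2}` and `c = 2c₀` (ours: the printed exponent is `1/c₀`).

* (private) `geom_factor_le_two` — `1 + Σ_{k=1}^{n} a^{k−1}·b^k ≤ 2` for `0 ≤ b ≤ 1/2`, `a·b ≤ 1/2` (used with `a = Δ_Q²`, `b = √y`);
* ★ `fgl18b_theorem13_parameter` — clause (iii) of `fgl18b_theorem13_expander` with the uniform parameter `2^{1 + max Δ/2}·p^{1/(2c₀)}`
  (i.e. `(2√y)^{|S|}`), under `Δ_Q²·√y ≤ 1/2`.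

Column word: PROVED (kernel); no definitions, no named facts.
-/

namespace Literature.InformationTheory.QuantumCodes

open Finset Matrix Literature.Probability.LatticeModels

namespace QuantumExpander

variable {A B : Type*} [Fintype A] [Fintype B] [DecidableEq A] [DecidableEq B]

omit [Fintype A] [Fintype B] [DecidableEq A] [DecidableEq B] in
/-- The size-dependent factor is at most `2` in the small-noise regime: for `0 ≤ b ≤ 1/2` and `a ≥ 0` with `a·b ≤ 1/2`,
`1 + Σ_{k=1}^{n} a^{k−1} b^k ≤ 2` (`Σ ≤ b·Σ_j (ab)^j ≤ 2b ≤ 1`). [folklore] -/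
private theorem geom_factor_le_two {a b : ℝ} (ha : 0 ≤ a) (hb0 : 0 ≤ b) (hb : b ≤ 1 / 2) (hab : a * b ≤ 1 / 2) (n : ℕ) :
    1 + ∑ k ∈ Finset.Icc 1 n, a ^ (k - 1) * b ^ k ≤ 2 := by
  -- termwise `a^{k-1} b^k = b (ab)^{k-1} ≤ b (1/2)^{k-1}`
  have hterm : ∀ k ∈ Finset.Icc 1 n, a ^ (k - 1) * b ^ k ≤ b * (1 / 2) ^ (k - 1) := by
    intro k hk
    have hk1 : 1 ≤ k := (Finset.mem_Icc.1 hk).1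
    have hsplit : a ^ (k - 1) * b ^ k = b * (a * b) ^ (k - 1) := by
      have : b ^ k = b * b ^ (k - 1) := by
        rw [← pow_succ']; congr 1; omega
      rw [this, mul_pow]; ring
    rw [hsplit]
    exact mul_le_mul_of_nonneg_left (pow_le_pow_left₀ (mul_nonneg ha hb0) hab _) hb0
  have hsum : ∑ k ∈ Finset.Icc 1 n, a ^ (k - 1) * b ^ k ≤ ∑ k ∈ Finset.Icc 1 n, b * (1 / 2 : ℝ) ^ (k - 1) :=
    Finset.sum_le_sum hterm
  -- `Σ_{k=1}^{n} (1/2)^{k-1} ≤ 2`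
  have hgeom : ∑ k ∈ Finset.Icc 1 n, b * (1 / 2 : ℝ) ^ (k - 1) ≤ b * 2 := by
    rw [← Finset.mul_sum]
    refine mul_le_mul_of_nonneg_left ?_ hb0
    have hreindex : ∑ k ∈ Finset.Icc 1 n, (1 / 2 : ℝ) ^ (k - 1) = ∑ j ∈ Finset.range n, (1 / 2 : ℝ) ^ j := by
      have h := (Finset.sum_image (s := Finset.range n) (g := fun j => j + 1) (f := fun k => (1 / 2 : ℝ) ^ (k - 1))
        (by intro x _ y _ hxy; simpa using hxy))
      have himg : (Finset.range n).image (fun j => j + 1) = Finset.Icc 1 n := by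
        ext k
        simp only [Finset.mem_image, Finset.mem_range, Finset.mem_Icc]
        constructor
        · rintro ⟨j, hj, rfl⟩; omega
        · intro hk; exact ⟨k - 1, by omega, by omega⟩
      rw [himg] at h
      rw [h]
      exact Finset.sum_congr rfl fun j _ => by simp
    rw [hreindex, geom_sum_eq (by norm_num : (1 / 2 : ℝ) ≠ 1)]
    have h2 : ((1 / 2 : ℝ) ^ n - 1) / (1 / 2 - 1) = 2 * (1 - (1 / 2 : ℝ) ^ n) := by ring
    rw [h2]
    have : (0 : ℝ) ≤ (1 / 2 : ℝ) ^ n := by positivity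
    linarith
  linarith

open scoped Classical in
/-- ★ **FGL18b Theorem 13, printed shape with a UNIFORM parameter (our constants).** Under the hypotheses of `fgl18b_theorem13_expander` and the
small-noise condition `Δ_Q²·√y ≤ 1/2`, `√y ≤ 1/2` (`y = 2^{max Δ}·p^{1/c₀}`, `Δ_Q = 2·max Δ·(Δ_A+Δ_B−1)` — conditions on `p` alone), the minimum-weight
residual `E_ls` of one noisy round of ANY tree small-set-flip decoder is, restricted to succ, locally stochastic with parameter `2√y = 2^{1+max Δ/2}·p^{1/(2c₀)}`:
for every `S ⊆ V`, `Σ_{X ∈ succ, S ⊆ supp E_ls(X)} μ X ≤ (2√y)^{|S|}`; together with clauses (i) (succᶜ exponentially unlikely) and (ii) (`E_ls ≡ E ⊕ Ê`)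
of `fgl18b_theorem13_expander`. (Printed: parameter `K·p_synd^{1/c₀}`; here `K = 2^{1+max Δ/2}` and exponent `1/(2c₀)`.)
[cite: FawziGrospellierLeverrier2018FT, Thm 13 (arXiv p0016 L66-73) and the end of its proof (p0022 L19-20)] -/
theorem fgl18b_theorem13_parameter (H : Matrix B A (ZMod 2)) {dA dB : ℕ} {γA δA γB δB : ℝ}
    (hreg : IsBiregular H dA dB) (hexp : IsLeftRightExpanding H dA dB γA δA γB δB)
    (hdA : 0 < dA) (hdB : 0 < dB) (hδA : 0 ≤ δA) (hδB : 0 ≤ δB)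
    {κ : ℝ} (hκ0 : 0 < κ) (hκ1 : 2 * κ < ((min dA dB : ℕ) : ℝ) * (1 - 16 * max δA δB))
    (Dec : Decoder (A × B → ZMod 2) ((A × A) ⊕ (B × B) → ZMod 2))
    (hDec : IsSSFDecoder κ (expanderHX H) (expanderHZ H) Dec)
    {μ : Finset (((A × A) ⊕ (B × B)) ⊕ (A × B)) → ℝ} {p : ℝ} (hμ : IsLocallyStochastic μ p) (hp0 : 0 ≤ p) (hp1 : p ≤ 1)
    {t : ℕ} (ht : ((max dA dB : ℕ) : ℝ) * t ≤ ((min dA dB : ℕ) : ℝ) * min (γA * Fintype.card A) (γB * Fintype.card B))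
    (hsmall : Real.sqrt ((2 : ℝ) ^ (max dA dB) * p ^ (1 / (4 / (((min dA dB : ℕ) : ℝ) * (1 - 16 * max δA δB) - 2 * κ)))) ≤ 1 / 2)
    (hsmall' : ((2 * max dA dB * (dA + dB - 1) : ℕ) : ℝ) ^ 2
        * Real.sqrt ((2 : ℝ) ^ (max dA dB) * p ^ (1 / (4 / (((min dA dB : ℕ) : ℝ) * (1 - 16 * max δA δB) - 2 * κ)))) ≤ 1 / 2)
    (hr : 2 * ((2 * max dA dB * (dA + dB - 1) + (dA + dB) : ℕ) : ℝ) ^ 2 * p ^ (κ / (2 * (κ + ((max dA dB : ℕ) : ℝ)))) < 1) :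
    ∃ eLs : Finset (((A × A) ⊕ (B × B)) ⊕ (A × B)) → ((A × A) ⊕ (B × B) → ZMod 2),
      (∑ X ∈ univ.filter (fun X =>
          HasAlphaCluster (SmallSetFlip.syndromeAdjGraph (expanderHX H) (expanderHZ H))
            (κ / (2 * (κ + ((max dA dB : ℕ) : ℝ)))) (t + 1) X), μ X
        ≤ (Fintype.card (((A × A) ⊕ (B × B)) ⊕ (A × B)) : ℝ)
            * (2 * ((2 * max dA dB * (dA + dB - 1) + (dA + dB) : ℕ) : ℝ) ^ 2 * p ^ (κ / (2 * (κ + ((max dA dB : ℕ) : ℝ))))) ^ (t + 1)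
          / (((2 * max dA dB * (dA + dB - 1) + (dA + dB) : ℕ) : ℝ) ^ 2
            * (1 - 2 * ((2 * max dA dB * (dA + dB - 1) + (dA + dB) : ℕ) : ℝ) ^ 2 * p ^ (κ / (2 * (κ + ((max dA dB : ℕ) : ℝ))))))) ∧
      (∀ X, ¬ HasAlphaCluster (SmallSetFlip.syndromeAdjGraph (expanderHX H) (expanderHZ H))
          (κ / (2 * (κ + ((max dA dB : ℕ) : ℝ)))) (t + 1) X →
        eLs X + (flipVec (univ.filter fun q => Sum.inl q ∈ X)
          + Dec (expanderHX H *ᵥ flipVec (univ.filter fun q => Sum.inl q ∈ X)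
              + flipVec (univ.filter fun c => Sum.inr c ∈ X))) ∈ rowSpace (expanderHZ H)) ∧
      ∀ S : Finset ((A × A) ⊕ (B × B)),
        ∑ X ∈ univ.filter (fun X =>
            ¬ HasAlphaCluster (SmallSetFlip.syndromeAdjGraph (expanderHX H) (expanderHZ H))
                (κ / (2 * (κ + ((max dA dB : ℕ) : ℝ)))) (t + 1) X ∧ S ⊆ supp (eLs X)), μ X
          ≤ (2 * Real.sqrt ((2 : ℝ) ^ (max dA dB) * p ^ (1 / (4 / (((min dA dB : ℕ) : ℝ) * (1 - 16 * max δA δB) - 2 * κ)))))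
              ^ S.card := by
  classical
  have hy1 : (2 : ℝ) ^ (max dA dB) * p ^ (1 / (4 / (((min dA dB : ℕ) : ℝ) * (1 - 16 * max δA δB) - 2 * κ))) ≤ 1 := by
    have hy0 : 0 ≤ (2 : ℝ) ^ (max dA dB) * p ^ (1 / (4 / (((min dA dB : ℕ) : ℝ) * (1 - 16 * max δA δB) - 2 * κ))) :=
      mul_nonneg (pow_nonneg (by norm_num) _) (Real.rpow_nonneg hp0 _)
    have h := Real.sq_sqrt hy0
    nlinarith [Real.sqrt_nonneg ((2 : ℝ) ^ (max dA dB) * p ^ (1 / (4 / (((min dA dB : ℕ) : ℝ) * (1 - 16 * max δA δB) - 2 * κ))))]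
  obtain ⟨eLs, hi, hii, hiii⟩ := fgl18b_theorem13_expander H hreg hexp hdA hdB hδA hδB hκ0 hκ1 Dec hDec hμ hp0 hp1 ht hy1 hr
  refine ⟨eLs, hi, hii, fun S => (hiii S).trans ?_⟩
  set b : ℝ := Real.sqrt ((2 : ℝ) ^ (max dA dB) * p ^ (1 / (4 / (((min dA dB : ℕ) : ℝ) * (1 - 16 * max δA δB) - 2 * κ)))) with hb
  have hb0 : 0 ≤ b := Real.sqrt_nonneg _
  -- `Δ_Q^{2(k-1)} = (Δ_Q²)^{k-1}`
  have hfac : 1 + ∑ k ∈ Finset.Icc 1 (Fintype.card ((A × A) ⊕ (B × B))),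
        ((2 * max dA dB * (dA + dB - 1) : ℕ) : ℝ) ^ (2 * (k - 1)) * b ^ k ≤ 2 := by
    have h := geom_factor_le_two (a := ((2 * max dA dB * (dA + dB - 1) : ℕ) : ℝ) ^ 2) (b := b)
      (by positivity) hb0 hsmall hsmall' (Fintype.card ((A × A) ⊕ (B × B)))
    refine le_trans (le_of_eq ?_) h
    congr 1
    refine Finset.sum_congr rfl fun k _ => ?_
    rw [← pow_mul]
  calc (b * (1 + ∑ k ∈ Finset.Icc 1 (Fintype.card ((A × A) ⊕ (B × B))),
          ((2 * max dA dB * (dA + dB - 1) : ℕ) : ℝ) ^ (2 * (k - 1)) * b ^ k)) ^ S.card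
      ≤ (b * 2) ^ S.card := by
        refine pow_le_pow_left₀ (mul_nonneg hb0 ?_) (mul_le_mul_of_nonneg_left hfac hb0) _
        exact add_nonneg zero_le_one (Finset.sum_nonneg fun k _ => by positivity)
    _ = (2 * b) ^ S.card := by rw [mul_comm]

end QuantumExpander

end Literature.InformationTheory.QuantumCodes
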